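import Summits.BirchSwinnertonDyer.BirchSwinnertonDyer.Theorems.SchneiderFreeAdditiveX3BranchIMCIsogenyTransport
import HarnessLib

/-!
# Route `SchneiderFreeAdditiveX3` (K1 door), crux `GordTwoBranchIMC` (stmt-BirchSwinnertonDyer-19177):
# `ord_p f_ac(0)` and `Ch_Λ(X_ac)` along an isogeny — the control value is lattice-robust given `μ = 0`

Cell `bsd-schneider-ideate`, seat `bsd-schneider-door-c3` (prover, generation 5). HONEST FRAMING: a
short composition of this seat's generation-4 files (`…BranchIMCLatticeTransport.lean`:
`hasCharValuationAt_le_transport`, `charIdeal_le_of_linearMap_of_muInvariant_eq_zero'`;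
`…AnticyclotomicSelmerIsogeny.lean` / `…BranchIMCIsogenyTransport.lean`: the Λ-linear transpose
`X_ac(φ)` of an isogeny with its `p`-power-killed kernel/cokernel). NOTHING is asserted about BSD;
the crux `GordTwoBranchIMC` (Keller–Yin arXiv:2410.23241 Thm. 3.5.1 at the frame — PREPRINT) stays
OPEN; `--supports` material for item 19177 (the (M)-cell crux 19176 reads the same theorems: nothing
here depends on the reduction type).

WHAT IS PROVED. The control corner reads the crux through `XAc.HasCharValuationAt … n`
(`ord_p f_ac(0) = n`, Castella 2018 Thm. 2.3 shape; the receptacle `gordTwo_stub_divisibilityLe_of_halves`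
consumes exactly this `n`). Feeding the lattice transport the transpose of the DUAL isogeny
(a `Λ`-map `X_ac(W₁) → X_ac(W₂)` for `φ : W₁ → W₂`; `φ̂ ∘ φ = [deg φ] = φ ∘ φ̂`, tree
`Isogeny.exists_dual_of_isElliptic` + `Isogeny.surjective`; the prime-to-`p` part of `deg φ` is a
unit of `Λ`):
* `hasCharValuationAt_le_of_isogeny_of_isElliptic` / `…_of_ratIsogeny`: `n(W₁) ≤ n(W₂)` for ANY
  `K`-isogeny (resp. `ℚ`-isogeny read over `K`) of elliptic curves from a source with
  `μ(X_ac(W₁)) = 0`, both `X_ac` finitely generated;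
* `hasCharValuationAt_eq_…` and `xac_charIdeal_eq_…`: with `μ = 0` on BOTH sides the two valuations
  and the two characteristic ideals COINCIDE — among the `μ = 0` lattices of a class not only the door
  direction but Keller–Yin's EQUALITY is lattice-independent (their §3.3, p. 17: "the Iwasawa Main
  Conjectures will be independent from the choice of a lattice"); for a `μ > 0` lattice only
  `Ch(X') = (p^k)·Ch(X)` survives (gen 4 `exists_charIdeal_eq_span_C_pow_mul`).
Still external (as in generation 4): finite generation / torsion of both `X_ac` (control corner),
`μ = 0` for one lattice (Keller–Yin), nothing else.

References: Keller–Yin arXiv:2410.23241 §3.3 (p. 17), Thm. 3.5.1 (p. 20); Castella 2018 Thm. 2.3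
(arXiv:1704.06608 p. 5); Silverman AEC III.6.1–6.2; Washington §13.2.
-/

noncomputable section

open scoped Classical

open NumberField IsDedekindDomain Field PowerSeries
  Literature.NumberTheory.EllipticCurves
  Summit.BirchSwinnertonDyer.Rank1Residual.X11b.AcSelmer

set_option linter.dupNamespace false -- D-0017 layout: summit = sub-problem (mandated namespace)
set_option autoImplicit false

universe u

namespace Summit.BirchSwinnertonDyer.BirchSwinnertonDyer.Theorems.SchneiderFree

/-! ## §6 `ord_p f_ac(0)` along an isogeny, and `Ch_Λ(X_ac)` as an invariant of the `μ = 0` members of an isogeny class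

The control corner reads the crux through `XAc.HasCharValuationAt … n` (`ord_p f_ac(0) = n`,
Castella 2018 Thm. 2.3 shape). Composing the lattice transport's `hasCharValuationAt_le_transport`
with the transpose of the DUAL isogeny (a `Λ`-map `X_ac(W₁) → X_ac(W₂)` for `φ : W₁ → W₂`) gives:
`n(W₁) ≤ n(W₂)` whenever `μ(X_ac(W₁)) = 0` — for any `K`-isogeny of elliptic curves (§6.1) and for a
`ℚ`-isogeny read over `K` (§6.2); with `μ = 0` on BOTH sides the two characteristic ideals and the
two valuations COINCIDE (the (M)-cell statement is the same theorem: nothing here depends on the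
reduction type). HONEST FRAMING: pure Iwasawa algebra + the comparison map; nothing asserted about
BSD; the crux stays OPEN (Keller–Yin arXiv:2410.23241 Thm. 3.5.1, PREPRINT). -/

section Valuation

open Literature.NumberTheory.EllipticCurves.IwasawaAlgebra

variable {K : Type u} [Field K] [NumberField K] {p : ℕ} [Fact p.Prime] {W₁ W₂ : WeierstrassCurve K}
  (κ : ZpExtension K p) (𝔭 : HeightOneSpectrum (𝓞 K)) (S : Set (HeightOneSpectrum (𝓞 K)))
  (γ : absoluteGaloisGroup K) [hγ : Fact (κ.IsTopGenerator γ)]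

omit [Fact p.Prime] in
/-- The two composition identities of an isogeny of elliptic curves with its dual, in the shape the
comparison-map lemmas consume: `deg φ = p^m · d` gives `φ̂ ∘ φ = [p^m d]` on `W₁(K̄)` (tree
`Isogeny.exists_dual_of_isElliptic`) and `φ ∘ φ̂ = [p^m d]` on `W₂(K̄)` (because `φ` is onto, tree
`Isogeny.surjective`). [cite: SilvermanAEC2009, Thm. III.6.1(a) and Thm. III.6.2(a)] -/
theorem exists_dual_comp_eq_nsmul [W₁.IsElliptic] [W₂.IsElliptic]
    (φ : WeierstrassCurve.Isogeny W₁ W₂) {m d : ℕ} (hdeg : φ.degree = p ^ m * d) :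
    ∃ ψ : WeierstrassCurve.Isogeny W₂ W₁,
      (∀ P : W₁.geomPoints, ψ (φ P) = (p ^ m * d) • P) ∧
        ∀ Q : W₂.geomPoints, φ (ψ Q) = (p ^ m * d) • Q := by
  obtain ⟨ψ, hψ⟩ := φ.exists_dual_of_isElliptic
  have hψφ : ∀ P : W₁.geomPoints, ψ (φ P) = (p ^ m * d) • P := fun P ↦ by
    rw [hψ, hdeg, natCast_zsmul]
  refine ⟨ψ, hψφ, fun Q ↦ ?_⟩
  obtain ⟨P, rfl⟩ := φ.surjective Q
  rw [hψφ, map_nsmul]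

/-- **`ord_p f_ac(0)` can only grow along an isogeny from a `μ = 0` source.** For a `K`-isogeny of
elliptic curves `φ : W₁ → W₂` of degree `p^m · d`, `p ∤ d`, finitely generated `X_ac^Σ(W₁)`,
`X_ac^Σ(W₂)` at one frame `(κ, γ, 𝔭, Σ)` and `μ(X_ac(W₁)) = 0`: if `ord_p f_ac(W₁)(0) = n₁` and
`ord_p f_ac(W₂)(0) = n₂` (`XAc.HasCharValuationAt`) then `n₁ ≤ n₂`. Proof: the transpose
`X_ac(φ̂) : X_ac(W₁) → X_ac(W₂)` of the DUAL isogeny has kernel and cokernel killed by `p^m`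
(`xacComap_ker_smul_of_comp` / `xacComap_coker_smul_of_comp` with the roles of `φ, φ̂` exchanged),
and `hasCharValuationAt_le_transport` applies. Reading for the door: the control value of any other
lattice of the class never undercuts the one read on a `μ = 0` lattice (Keller–Yin's, §3.3 p. 17).
CONDITIONAL on the listed inputs; nothing asserted about BSD.
[cite: Castella2018, Thm. 2.3 (arXiv:1704.06608 p. 5) (shape only)]
[cite: KellerYin2024b, §3.3 (arXiv:2410.23241 p. 17) (shape only; preprint)] [cite: Washington1997, §13.2] -/
theorem hasCharValuationAt_le_of_isogeny_of_isElliptic [W₁.IsElliptic] [W₂.IsElliptic]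
    (φ : WeierstrassCurve.Isogeny W₁ W₂) {m d : ℕ} (hdeg : φ.degree = p ^ m * d) (hd : ¬ p ∣ d)
    [Module.Finite (IwasawaAlgebra p) (XAc W₁ p κ 𝔭 S γ)]
    [Module.Finite (IwasawaAlgebra p) (XAc W₂ p κ 𝔭 S γ)]
    (hμ : muInvariant p (XAc W₁ p κ 𝔭 S γ) = 0)
    {n₁ n₂ : ℕ} (hn₁ : XAc.HasCharValuationAt W₁ p κ 𝔭 S γ n₁)
    (hn₂ : XAc.HasCharValuationAt W₂ p κ 𝔭 S γ n₂) : n₁ ≤ n₂ := by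
  obtain ⟨ψ, hψφ, hφψ⟩ := exists_dual_comp_eq_nsmul (p := p) φ hdeg
  -- the transpose of the dual isogeny `ψ : W₂ → W₁` is a `Λ`-map `X_ac(W₁) → X_ac(W₂)`; its
  -- quasi-inverse data are `ψ ∘ φ = [p^m d]` (kernel) and `φ ∘ ψ = [p^m d]` (cokernel)
  exact hasCharValuationAt_le_transport W₁ W₂ κ 𝔭 S γ hμ
    (xacComap W₂ W₁ κ 𝔭 S (isogenyPrimaryMap ψ) (isogenyPrimaryMap_smul ψ) γ) m
    (fun x hx ↦ xacComap_ker_smul_of_comp κ 𝔭 S γ ψ φ hd hψφ x hx)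
    (fun y ↦ xacComap_coker_smul_of_comp κ 𝔭 S γ ψ φ hd hφψ y) hn₁ hn₂

/-- **`ord_p f_ac(0)` is an invariant of the `μ = 0` lattices of an isogeny class**: with `μ = 0` on
BOTH `X_ac^Σ(W₁)` and `X_ac^Σ(W₂)`, `n₁ = n₂` (the previous theorem along `φ` and along `φ̂`, whose
degree is again `p^m · d`). CONDITIONAL; nothing asserted about BSD.
[cite: Castella2018, Thm. 2.3 (arXiv:1704.06608 p. 5) (shape only)] [cite: Washington1997, §13.2] -/
theorem hasCharValuationAt_eq_of_isogeny_of_isElliptic [W₁.IsElliptic] [W₂.IsElliptic]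
    (φ : WeierstrassCurve.Isogeny W₁ W₂) {m d : ℕ} (hdeg : φ.degree = p ^ m * d) (hd : ¬ p ∣ d)
    [Module.Finite (IwasawaAlgebra p) (XAc W₁ p κ 𝔭 S γ)]
    [Module.Finite (IwasawaAlgebra p) (XAc W₂ p κ 𝔭 S γ)]
    (hμ₁ : muInvariant p (XAc W₁ p κ 𝔭 S γ) = 0) (hμ₂ : muInvariant p (XAc W₂ p κ 𝔭 S γ) = 0)
    {n₁ n₂ : ℕ} (hn₁ : XAc.HasCharValuationAt W₁ p κ 𝔭 S γ n₁)
    (hn₂ : XAc.HasCharValuationAt W₂ p κ 𝔭 S γ n₂) : n₁ = n₂ := by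
  refine le_antisymm (hasCharValuationAt_le_of_isogeny_of_isElliptic κ 𝔭 S γ φ hdeg hd hμ₁ hn₁ hn₂)
    ?_
  obtain ⟨ψ, hψφ, hφψ⟩ := exists_dual_comp_eq_nsmul (p := p) φ hdeg
  -- along `ψ : W₂ → W₁`, whose quasi-inverse is `φ`
  exact hasCharValuationAt_le_transport W₂ W₁ κ 𝔭 S γ hμ₂
    (xacComap W₁ W₂ κ 𝔭 S (isogenyPrimaryMap φ) (isogenyPrimaryMap_smul φ) γ) m
    (fun x hx ↦ xacComap_ker_smul_of_comp κ 𝔭 S γ φ ψ hd hφψ x hx)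
    (fun y ↦ xacComap_coker_smul_of_comp κ 𝔭 S γ φ ψ hd hψφ y) hn₂ hn₁

/-- **`Ch_Λ(X_ac^Σ)` is an invariant of the `μ = 0` lattices of an isogeny class**: with finitely
generated torsion `X_ac^Σ(W₁)`, `X_ac^Σ(W₂)` and `μ = 0` on BOTH, the two characteristic ideals are
EQUAL (`xac_charIdeal_le_of_isogeny_of_isElliptic` along `φ` and along `φ̂`). Reading: among the
lattices of the class with `μ = 0` (Keller–Yin's normalisation, §3.3 p. 17: "the Iwasawa Main
Conjectures will be independent from the choice of a lattice") not only the door direction but the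
EQUALITY of Thm. 3.5.1 is lattice-independent; for a lattice with `μ > 0` only "⊇·(p^k)" survives
(`exists_charIdeal_eq_span_C_pow_mul`). CONDITIONAL; nothing asserted about BSD.
[cite: KellerYin2024b, §3.3 (arXiv:2410.23241 p. 17) (shape only; preprint)] [cite: Washington1997, §13.2] -/
theorem xac_charIdeal_eq_of_isogeny_of_isElliptic [W₁.IsElliptic] [W₂.IsElliptic]
    (φ : WeierstrassCurve.Isogeny W₁ W₂) {m d : ℕ} (hdeg : φ.degree = p ^ m * d) (hd : ¬ p ∣ d)
    [Module.Finite (IwasawaAlgebra p) (XAc W₁ p κ 𝔭 S γ)]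
    [Module.Finite (IwasawaAlgebra p) (XAc W₂ p κ 𝔭 S γ)]
    (h₁ : Module.IsTorsion (IwasawaAlgebra p) (XAc W₁ p κ 𝔭 S γ))
    (h₂ : Module.IsTorsion (IwasawaAlgebra p) (XAc W₂ p κ 𝔭 S γ))
    (hμ₁ : muInvariant p (XAc W₁ p κ 𝔭 S γ) = 0) (hμ₂ : muInvariant p (XAc W₂ p κ 𝔭 S γ) = 0) :
    XAc.charIdeal W₁ p κ 𝔭 S γ = XAc.charIdeal W₂ p κ 𝔭 S γ := by
  refine le_antisymm ?_ (xac_charIdeal_le_of_isogeny_of_isElliptic κ 𝔭 S γ φ hdeg hd h₁ h₂ hμ₁)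
  obtain ⟨ψ, hψφ, hφψ⟩ := exists_dual_comp_eq_nsmul (p := p) φ hdeg
  exact charIdeal_le_of_linearMap_of_muInvariant_eq_zero' h₂ h₁ hμ₂
    (xacComap W₂ W₁ κ 𝔭 S (isogenyPrimaryMap ψ) (isogenyPrimaryMap_smul ψ) γ) m
    (fun x hx ↦ xacComap_ker_smul_of_comp κ 𝔭 S γ ψ φ hd hψφ x hx)
    (fun y ↦ xacComap_coker_smul_of_comp κ 𝔭 S γ ψ φ hd hφψ y)

end Valuation

/-! ### §6.2 The door's curves: a `ℚ`-isogeny of the class, read over the Heegner field `K` -/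

section RatValuation

open Literature.NumberTheory.EllipticCurves.IwasawaAlgebra

variable {p : ℕ} [Fact p.Prime] {W₁ W₂ : WeierstrassCurve ℚ} [W₁.IsElliptic] [W₂.IsElliptic]
  {K : Type} [Field K] [NumberField K]
  (κ : ZpExtension K p) (𝔭 : HeightOneSpectrum (𝓞 K)) (S : Set (HeightOneSpectrum (𝓞 K)))
  (γ : absoluteGaloisGroup K) [hγ : Fact (κ.IsTopGenerator γ)]

/-- **`ord_p f_ac(0)` grows along every `ℚ`-isogeny from a `μ = 0` member of the class, read over
`K`.** For elliptic curves `W₁, W₂ /ℚ`, a `ℚ`-isogeny `φ : W₁ → W₂` of degree `p^m · d`, `p ∤ d`,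
a number field `K` and one frame `(κ, γ, 𝔭, Σ)`: if both `X_ac^Σ((Wᵢ)_K)` are finitely generated,
`μ(X_ac((W₁)_K)) = 0`, `ord_p f_ac((W₁)_K)(0) = n₁` and `ord_p f_ac((W₂)_K)(0) = n₂`, then
`n₁ ≤ n₂` (`Isogeny.extendScalars K`, same degree). This is the `HasCharValuationAt` companion of
`xac_charIdeal_le_of_ratIsogeny` — the form in which the crux's receptacle
(`gordTwo_stub_divisibilityLe_of_halves`, via `XAc.HasCharValuationAt … n`) meets the lattice
question. CONDITIONAL; nothing asserted about BSD. [cite: SilvermanAEC2009, III.§4 (p. 66) and Thm. III.6.1(a)]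
[cite: Castella2018, Thm. 2.3 (arXiv:1704.06608 p. 5) (shape only)] -/
theorem hasCharValuationAt_le_of_ratIsogeny (φ : WeierstrassCurve.Isogeny W₁ W₂) {m d : ℕ}
    (hdeg : φ.degree = p ^ m * d) (hd : ¬ p ∣ d)
    [Module.Finite (IwasawaAlgebra p) (XAc (W₁.baseChange K) p κ 𝔭 S γ)]
    [Module.Finite (IwasawaAlgebra p) (XAc (W₂.baseChange K) p κ 𝔭 S γ)]
    (hμ : muInvariant p (XAc (W₁.baseChange K) p κ 𝔭 S γ) = 0)
    {n₁ n₂ : ℕ} (hn₁ : XAc.HasCharValuationAt (W₁.baseChange K) p κ 𝔭 S γ n₁)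
    (hn₂ : XAc.HasCharValuationAt (W₂.baseChange K) p κ 𝔭 S γ n₂) : n₁ ≤ n₂ :=
  hasCharValuationAt_le_of_isogeny_of_isElliptic κ 𝔭 S γ (φ.extendScalars K)
    (by rw [WeierstrassCurve.Isogeny.degree_extendScalars, hdeg]) hd hμ hn₁ hn₂

/-- **`ord_p f_ac(0)` is the same for all `μ = 0` members of a `ℚ`-isogeny class, read over `K`.**
CONDITIONAL; nothing asserted about BSD. [cite: Castella2018, Thm. 2.3 (arXiv:1704.06608 p. 5) (shape only)] -/
theorem hasCharValuationAt_eq_of_ratIsogeny (φ : WeierstrassCurve.Isogeny W₁ W₂) {m d : ℕ}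
    (hdeg : φ.degree = p ^ m * d) (hd : ¬ p ∣ d)
    [Module.Finite (IwasawaAlgebra p) (XAc (W₁.baseChange K) p κ 𝔭 S γ)]
    [Module.Finite (IwasawaAlgebra p) (XAc (W₂.baseChange K) p κ 𝔭 S γ)]
    (hμ₁ : muInvariant p (XAc (W₁.baseChange K) p κ 𝔭 S γ) = 0)
    (hμ₂ : muInvariant p (XAc (W₂.baseChange K) p κ 𝔭 S γ) = 0)
    {n₁ n₂ : ℕ} (hn₁ : XAc.HasCharValuationAt (W₁.baseChange K) p κ 𝔭 S γ n₁)
    (hn₂ : XAc.HasCharValuationAt (W₂.baseChange K) p κ 𝔭 S γ n₂) : n₁ = n₂ :=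
  hasCharValuationAt_eq_of_isogeny_of_isElliptic κ 𝔭 S γ (φ.extendScalars K)
    (by rw [WeierstrassCurve.Isogeny.degree_extendScalars, hdeg]) hd hμ₁ hμ₂ hn₁ hn₂

/-- **`Ch_Λ(X_ac^Σ(E_K))` is the same for all `μ = 0` members of a `ℚ`-isogeny class** (finitely
generated torsion on both sides). CONDITIONAL; nothing asserted about BSD.
[cite: KellerYin2024b, §3.3 (arXiv:2410.23241 p. 17) (shape only; preprint)] [cite: Washington1997, §13.2] -/
theorem xac_charIdeal_eq_of_ratIsogeny (φ : WeierstrassCurve.Isogeny W₁ W₂) {m d : ℕ}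
    (hdeg : φ.degree = p ^ m * d) (hd : ¬ p ∣ d)
    [Module.Finite (IwasawaAlgebra p) (XAc (W₁.baseChange K) p κ 𝔭 S γ)]
    [Module.Finite (IwasawaAlgebra p) (XAc (W₂.baseChange K) p κ 𝔭 S γ)]
    (h₁ : Module.IsTorsion (IwasawaAlgebra p) (XAc (W₁.baseChange K) p κ 𝔭 S γ))
    (h₂ : Module.IsTorsion (IwasawaAlgebra p) (XAc (W₂.baseChange K) p κ 𝔭 S γ))
    (hμ₁ : muInvariant p (XAc (W₁.baseChange K) p κ 𝔭 S γ) = 0)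
    (hμ₂ : muInvariant p (XAc (W₂.baseChange K) p κ 𝔭 S γ) = 0) :
    XAc.charIdeal (W₁.baseChange K) p κ 𝔭 S γ = XAc.charIdeal (W₂.baseChange K) p κ 𝔭 S γ :=
  xac_charIdeal_eq_of_isogeny_of_isElliptic κ 𝔭 S γ (φ.extendScalars K)
    (by rw [WeierstrassCurve.Isogeny.degree_extendScalars, hdeg]) hd h₁ h₂ hμ₁ hμ₂

end RatValuation

end Summit.BirchSwinnertonDyer.BirchSwinnertonDyer.Theorems.SchneiderFree

end
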